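import Literature.RingTheory.MvPolynomial.KaltofenOstrowskiProofs
import Literature.RingTheory.MvPolynomial.KaltofenNoetherFormsThm7Proofs
import HarnessLib

/-!
# Kaltofen's effective Ostrowski theorem (Thm. 8): the discharge `kaltofen1995_thm8_holds`

Topic `Literature/RingTheory/MvPolynomial`. Discharge (librarian, fact-decomposition pass of
2026-08-16; pure composition, no definition, no named fact) of the named fact
`Literature.RingTheory.MvPolynomial.kaltofen1995_thm8` (`KaltofenNoetherForms.lean`; E. Kaltofen,
*Effective Noether irreducibility forms and applications*, J. Comput. System Sci. 50 (1995), §6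
Thm. 8): the printed proof of Thm. 8 from Thm. 7 is `kaltofen1995_thm8_of_thm7`
(`KaltofenOstrowskiProofs.lean`), and Thm. 7 — the effective Noether forms — is now itself proved,
`kaltofen1995_thm7_holds` (`KaltofenNoetherFormsThm7Proofs.lean`). No split is needed.

## References

* E. Kaltofen, J. Comput. System Sci. 50 (1995) 274–295, §5 Thm. 7, §6 Thm. 8. [Kaltofen1995]
-/

noncomputable section

namespace Literature.RingTheory.MvPolynomial

/-- **Kaltofen 1995, Theorem 8 (effective Ostrowski theorem) holds**: discharge of the named fact
`kaltofen1995_thm8`, by the printed proof from Thm. 7 (`kaltofen1995_thm8_of_thm7`) and the proof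
of Thm. 7 (`kaltofen1995_thm7_holds`). [cite: Kaltofen1995, Thm. 8] -/
theorem kaltofen1995_thm8_holds : kaltofen1995_thm8 :=
  kaltofen1995_thm8_of_thm7 kaltofen1995_thm7_holds

end Literature.RingTheory.MvPolynomial

end
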